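import Literature.Topology.FourManifolds.FishtailSection
import Literature.Topology.FourManifolds.FishtailChartSwitch
import Literature.Topology.FourManifolds.MTorusCoordinates
import Literature.Topology.FourManifolds.FishtailTubeALocal
import HarnessLib

/-!
# The tube about Gompf's disc in the north cap chart

Infrastructure for the explicit fishtail neighbourhood (R. Gompf, *More Cappell–Shaneson spheres
are standard*, Algebr. Geom. Topol. 10 (2010), proof of Thm 2.1 and Lemma 2.2; the named fact
`Literature.Topology.FourManifolds.gompf2010_framedTwist`). Away from the collar annulus the disc
`D` is the graph `{y = 0, z₃ = σ(d)}` of the circle-valued section `σ = sigmaCapC`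
(`FishtailSection.lean`) over the north cap chart `d` (`FishtailCoordinates.lean`), and its tube
is the *vertical* one: the offset `(a, b)` moves `y` to `λ a` and the fibre to `σ(d) e^{-iλb}`.
This file provides this tube and its calculus:

* `Literature.Topology.FourManifolds.capS_capPt'` (the cap chart identity on the whole sector
  `1/2 < s < 3/2`) and `Literature.Topology.FourManifolds.capChart ε` — **the cap chart
  `d ↦ (capN ε d, capS d)` as a partial diffeomorphism** `slitPlane ≅ {n² < ε², n < 0, 1/2 < s < 3/2}`
  with inverse `capPt`;
* `Literature.Topology.FourManifolds.northT3`, `Literature.Topology.FourManifolds.northTube` —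
  **the tube** `(d, a, b) ↦ ((e^{i n} z₃⁻¹, e^{iλa}, z₃), s)`, `n = capN ε d`, `s = capS d`,
  `z₃ = σ(d) e^{-iλb}`: smooth where `σ` is (`contMDiffAt_northTube`), injective for small
  offsets (`northTube_inj`);
* `Literature.Topology.FourManifolds.isLocalDiffeomorphAt_mtPt_northTube` — read in the mapping
  torus through `mtPt`, the tube is a local diffeomorphism (a real lift of `σ` near the point turns
  it into the cap chart followed by shears, `isLocalDiffeomorphAt_graph`, and the exponential
  coordinates `isLocalDiffeomorphAt_mtCoord`).

Everything is proved; no named facts.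

## References

* R. E. Gompf, *More Cappell–Shaneson spheres are standard*, Algebr. Geom. Topol. 10 (2010)
  1665–1681, proof of Thm 2.1 (`F′`, `D`) and Lemma 2.2. [GompfAGT2010]
-/

noncomputable section

open scoped Real ContDiff Topology Manifold
open Set Function Filter Complex

namespace Literature.Topology.FourManifolds

local notation "𝔼" n => EuclideanSpace ℝ (Fin n)
local notation "𝓣" =>
  (ModelWithCorners.prod (𝓡 1) (ModelWithCorners.prod (𝓡 1) (𝓡 1)))

/-! ### The cap chart as a partial diffeomorphism -/

section CapChart

variable {ε : ℝ}

/-- `arg d(n, s) = 2πs - 2π` on the whole sector `1/2 < s < 3/2`. [folklore] -/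
theorem arg_capPt' {n : ℝ} (hn : n ^ 2 < ε ^ 2) (hn0 : n < 0) {s : ℝ} (hs1 : 1 / 2 < s) (hs2 : s < 3 / 2) :
    arg (capPt ε n s) = 2 * π * s - 2 * π := by
  have ht : 0 < capRad ε n := capRad_pos hn hn0
  have hexp : exp (2 * π * s * I) = exp (↑(2 * π * s - 2 * π) * I) := by
    rw [show (↑(2 * π * s - 2 * π) : ℂ) * I = 2 * π * s * I - 2 * π * I by push_cast; ring,
      Complex.exp_sub, exp_two_pi_mul_I, div_one]
  rw [capPt, hexp, arg_real_mul _ ht, arg_exp_mul_I, toIocMod_eq_self]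
  constructor <;> nlinarith [Real.pi_pos]

/-- **`s(d(n, s)) = s`** on the whole sector `1/2 < s < 3/2`. [folklore] -/
theorem capS_capPt' {n : ℝ} (hn : n ^ 2 < ε ^ 2) (hn0 : n < 0) {s : ℝ} (hs1 : 1 / 2 < s) (hs2 : s < 3 / 2) :
    capS (capPt ε n s) = s := by
  rw [capS, arg_capPt' hn hn0 hs1 hs2, sub_div, mul_comm (2 * π) s, mul_div_assoc,
    div_self (ne_of_gt (by positivity)), mul_one]
  ring

/-- For `d` in the slit plane, `1/2 < capS d < 3/2`. [folklore] -/
theorem capS_mem_of_mem_slitPlane {d : ℂ} (hd : d ∈ slitPlane) : 1 / 2 < capS d ∧ capS d < 3 / 2 := by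
  have h1 := neg_pi_lt_arg d
  have h2 : arg d < π := lt_of_le_of_ne (arg_le_pi d) (mem_slitPlane_iff_arg.1 hd).1
  have hπ := Real.pi_pos
  rw [capS]
  constructor
  · have : -π / (2 * π) < arg d / (2 * π) := div_lt_div_of_pos_right h1 (by positivity)
    have e : -π / (2 * π) = -(1 / 2) := by field_simp
    linarith
  · have : arg d / (2 * π) < π / (2 * π) := div_lt_div_of_pos_right h2 (by positivity)
    have e : π / (2 * π) = 1 / 2 := by field_simp
    linarith

/-- The target of the cap chart. [folklore] -/
def capChartTarget (ε : ℝ) : Set (ℝ × ℝ) := {p | p.1 ^ 2 < ε ^ 2 ∧ p.1 < 0 ∧ 1 / 2 < p.2 ∧ p.2 < 3 / 2}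

/-- The target of the cap chart is open. [folklore] -/
theorem isOpen_capChartTarget (ε : ℝ) : IsOpen (capChartTarget ε) :=
  (isOpen_lt (continuous_fst.pow 2) continuous_const).inter ((isOpen_lt continuous_fst continuous_const).inter
    ((isOpen_lt continuous_const continuous_snd).inter (isOpen_lt continuous_snd continuous_const)))

/-- `capPt ε n s` lies in the slit plane for `(n, s)` in the target. [folklore] -/
theorem capPt_mem_slitPlane {p : ℝ × ℝ} (hp : p ∈ capChartTarget ε) : capPt ε p.1 p.2 ∈ slitPlane := by
  obtain ⟨hn, hn0, hs1, hs2⟩ := hp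
  rw [mem_slitPlane_iff_arg, arg_capPt' hn hn0 hs1 hs2]
  refine ⟨by nlinarith [Real.pi_pos], ?_⟩
  rw [capPt]
  exact mul_ne_zero (ofReal_ne_zero.2 (capRad_pos hn hn0).ne') (Complex.exp_ne_zero _)

variable (hε : 0 < ε)
include hε

/-- **The cap chart `d ↦ (capN ε d, capS d)` as a partial diffeomorphism** of the slit plane onto
`{n² < ε², n < 0, 1/2 < s < 3/2}`, inverse `(n, s) ↦ capPt ε n s`. [folklore] -/
def capChart : PartialDiffeomorph 𝓘(ℝ, ℂ) 𝓘(ℝ, ℝ × ℝ) ℂ (ℝ × ℝ) ∞ where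
  toFun d := (capN ε d, capS d)
  invFun p := capPt ε p.1 p.2
  source := slitPlane
  target := capChartTarget ε
  map_source' d hd := by
    have h0 : d ≠ 0 := slitPlane_ne_zero hd
    refine ⟨capLat_sq_lt hε _, capLat_neg hε (norm_pos_iff.2 h0), capS_mem_of_mem_slitPlane hd⟩
  map_target' _ hp := capPt_mem_slitPlane hp
  left_inv' d _ := capPt_capN_capS hε d
  right_inv' p hp := Prod.ext (capN_capPt hε hp.1 hp.2.1.le p.2) (capS_capPt' hp.1 hp.2.1 hp.2.2.1 hp.2.2.2)
  open_source := isOpen_slitPlane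
  open_target := isOpen_capChartTarget ε
  contMDiffOn_toFun := by
    refine fun d hd ↦ (ContMDiffAt.contMDiffWithinAt ?_)
    rw [contMDiffAt_iff_contDiffAt]
    exact (contDiffAt_capN ε (slitPlane_ne_zero hd)).prodMk (contDiffAt_capS hd)
  contMDiffOn_invFun := by
    rw [contMDiffOn_iff_contDiffOn]
    exact (contDiffOn_capPt ε).mono fun p hp ↦ hp.1

/-- The value of the cap chart. [folklore] -/
@[simp] theorem capChart_apply (d : ℂ) : capChart hε d = (capN ε d, capS d) := rfl

/-- The source of the cap chart. [folklore] -/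
@[simp] theorem capChart_source : (capChart hε).source = slitPlane := rfl

/-- **The cap chart is a local diffeomorphism** at every point of the slit plane. [folklore] -/
theorem isLocalDiffeomorphAt_capChart {d : ℂ} (hd : d ∈ slitPlane) :
    IsLocalDiffeomorphAt 𝓘(ℝ, ℂ) 𝓘(ℝ, ℝ × ℝ) ∞ (fun d ↦ (capN ε d, capS d)) d :=
  PartialDiffeomorph.isLocalDiffeomorphAt 𝓘(ℝ, ℂ) 𝓘(ℝ, ℝ × ℝ) ∞ (capChart hε) hd

end CapChart

/-! ### The tube in the north cap chart -/

section Tube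

variable (ε tj δ r₁ r₂ r₃ lam : ℝ)

/-- The fibre coordinate of the tube point: `z₃ = σ(d) e^{-iλb}`. [folklore] -/
def northZ3 (d : ℂ) (b : ℝ) : Circle := sigmaCapC tj δ r₁ r₂ r₃ d * Circle.exp (-(lam * b))

/-- **The tube point in `T³`**: `(e^{in} z₃⁻¹, e^{iλa}, z₃)`, `n = capN ε d`. [folklore] -/
def northT3 (d : ℂ) (a b : ℝ) : ThreeTorus :=
  (Circle.exp (capN ε d) * (northZ3 tj δ r₁ r₂ r₃ lam d b)⁻¹, Circle.exp (lam * a), northZ3 tj δ r₁ r₂ r₃ lam d b)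

/-- **The tube in the north cap chart** with its base coordinate `s = capS d`. [cite: GompfAGT2010, Lemma 2.2 (proof: the boundary of a tubular neighbourhood of D)] -/
def northTube (q : ℂ × ℝ × ℝ) : ThreeTorus × ℝ :=
  (northT3 ε tj δ r₁ r₂ r₃ lam q.1 q.2.1 q.2.2, capS q.1)

variable {ε tj δ r₁ r₂ r₃ lam}

/-- Smoothness of the fibre coordinate where `σ` is smooth. [folklore] -/
theorem contMDiffAt_northZ3 {q : ℂ × ℝ}
    (hσ : ContMDiffAt 𝓘(ℝ, ℂ) (𝓡 1) ∞ (sigmaCapC tj δ r₁ r₂ r₃) q.1) :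
    ContMDiffAt 𝓘(ℝ, ℂ × ℝ) (𝓡 1) ∞ (fun q : ℂ × ℝ ↦ northZ3 tj δ r₁ r₂ r₃ lam q.1 q.2) q := by
  unfold northZ3
  have h1 : ContMDiffAt 𝓘(ℝ, ℂ × ℝ) (𝓡 1) ∞ (fun q : ℂ × ℝ ↦ sigmaCapC tj δ r₁ r₂ r₃ q.1) q :=
    hσ.comp q contDiffAt_fst.contMDiffAt
  have h2 : ContMDiffAt 𝓘(ℝ, ℂ × ℝ) (𝓡 1) ∞ (fun q : ℂ × ℝ ↦ Circle.exp (-(lam * q.2))) q :=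
    contMDiff_circleExp.contMDiffAt.comp q ((contDiff_const.mul contDiff_snd).neg.contDiffAt.contMDiffAt)
  exact h1.mul h2

/-- **Smoothness of the tube** at points where `σ` is smooth and `d` is in the slit plane. [folklore] -/
theorem contMDiffAt_northTube {q : ℂ × ℝ × ℝ} (hd : q.1 ∈ slitPlane)
    (hσ : ContMDiffAt 𝓘(ℝ, ℂ) (𝓡 1) ∞ (sigmaCapC tj δ r₁ r₂ r₃) q.1) :
    ContMDiffAt 𝓘(ℝ, ℂ × ℝ × ℝ) (ModelWithCorners.prod 𝓣 𝓘(ℝ, ℝ)) ∞ (northTube ε tj δ r₁ r₂ r₃ lam) q := by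
  have h0 : q.1 ≠ 0 := slitPlane_ne_zero hd
  have hz : ContMDiffAt 𝓘(ℝ, ℂ × ℝ × ℝ) (𝓡 1) ∞ (fun q : ℂ × ℝ × ℝ ↦ northZ3 tj δ r₁ r₂ r₃ lam q.1 q.2.2) q := by
    have hp : ContMDiffAt 𝓘(ℝ, ℂ × ℝ × ℝ) 𝓘(ℝ, ℂ × ℝ) ∞ (fun q : ℂ × ℝ × ℝ ↦ (q.1, q.2.2)) q :=
      (contDiff_fst.prodMk (contDiff_snd.comp contDiff_snd)).contDiffAt.contMDiffAt
    exact (contMDiffAt_northZ3 (lam := lam) (q := (q.1, q.2.2)) hσ).comp q hp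
  have hn : ContMDiffAt 𝓘(ℝ, ℂ × ℝ × ℝ) (𝓡 1) ∞ (fun q : ℂ × ℝ × ℝ ↦ Circle.exp (capN ε q.1)) q :=
    contMDiff_circleExp.contMDiffAt.comp q (((contDiffAt_capN ε h0).comp q contDiffAt_fst).contMDiffAt)
  have ha : ContMDiffAt 𝓘(ℝ, ℂ × ℝ × ℝ) (𝓡 1) ∞ (fun q : ℂ × ℝ × ℝ ↦ Circle.exp (lam * q.2.1)) q :=
    contMDiff_circleExp.contMDiffAt.comp q ((contDiff_const.mul (contDiff_fst.comp contDiff_snd)).contDiffAt.contMDiffAt)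
  have hs : ContMDiffAt 𝓘(ℝ, ℂ × ℝ × ℝ) 𝓘(ℝ, ℝ) ∞ (fun q : ℂ × ℝ × ℝ ↦ capS q.1) q :=
    ((contDiffAt_capS hd).comp q contDiffAt_fst).contMDiffAt
  exact ((hn.mul hz.inv).prodMk (ha.prodMk hz)).prodMk hs

/-- **Injectivity of the tube**: for `0 < ε < π`, `0 < λ` and offsets with `|λa|, |λa'| < π`,
`|λb - λb'| < 2π`, equal tube points have equal `(d, a, b)`. [folklore] -/
theorem northTube_inj (hε : 0 < ε) (hεπ : ε < π) (hlam : 0 < lam) {d d' : ℂ} {a a' b b' : ℝ}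
    (ha : |lam * a| < π) (ha' : |lam * a'| < π) (hbb : |lam * b - lam * b'| < 2 * π)
    (h : northTube ε tj δ r₁ r₂ r₃ lam (d, a, b) = northTube ε tj δ r₁ r₂ r₃ lam (d', a', b')) :
    d = d' ∧ a = a' ∧ b = b' := by
  simp only [northTube, northT3, Prod.mk.injEq] at h
  obtain ⟨⟨h1, h2, h3⟩, hs⟩ := h
  -- `capN d = capN d'` from the first and third coordinates
  have hn : Circle.exp (capN ε d) = Circle.exp (capN ε d') := by
    have := congrArg (fun z : Circle ↦ z * northZ3 tj δ r₁ r₂ r₃ lam d b) h1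
    simp only [inv_mul_cancel_right] at this
    rw [h3] at this
    simpa using this
  have hN : capN ε d = capN ε d' := by
    have hb : |capN ε d| < π := lt_trans (abs_capLat_lt hε ‖d‖) hεπ
    have hb' : |capN ε d'| < π := lt_trans (abs_capLat_lt hε ‖d'‖) hεπ
    have e1 := Circle.arg_exp (x := capN ε d) (abs_lt.1 hb).1 (abs_lt.1 hb).2.le
    have e2 := Circle.arg_exp (x := capN ε d') (abs_lt.1 hb').1 (abs_lt.1 hb').2.le
    rw [← e1, ← e2, hn]
  have hd : d = d' := by
    rw [← capPt_capN_capS hε d, ← capPt_capN_capS hε d', hN, hs]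
  subst hd
  -- `a = a'`
  have hA : a = a' := by
    have e1 := Circle.arg_exp (x := lam * a) (by linarith [(abs_lt.1 ha).1]) (abs_lt.1 ha).2.le
    have e2 := Circle.arg_exp (x := lam * a') (by linarith [(abs_lt.1 ha').1]) (abs_lt.1 ha').2.le
    have : lam * a = lam * a' := by rw [← e1, ← e2, h2]
    exact mul_left_cancel₀ hlam.ne' this
  -- `b = b'`
  have hB : b = b' := by
    have e : Circle.exp (-(lam * b)) = Circle.exp (-(lam * b')) := mul_left_cancel h3
    have e' : Circle.exp (lam * b' - lam * b) = 1 := by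
      have := congrArg (fun z ↦ Circle.exp (lam * b') * z) e
      rw [← Circle.exp_add, ← Circle.exp_add, add_neg_cancel, Circle.exp_zero] at this
      rw [sub_eq_add_neg]; exact this
    obtain ⟨n, hn'⟩ := Circle.exp_eq_one.1 e'
    have hn0 : (n : ℝ) = 0 := by
      have habs : |(n : ℝ) * (2 * π)| < 2 * π := by rw [← hn', abs_sub_comm]; exact hbb
      rw [abs_mul, abs_of_pos (by positivity : (0 : ℝ) < 2 * π)] at habs
      have h1' : |(n : ℝ)| < 1 := by nlinarith [Real.pi_pos, abs_nonneg (n : ℝ)]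
      have : |n| < 1 := by exact_mod_cast h1'
      have : n = 0 := Int.abs_lt_one_iff.mp this
      simp [this]
    have : lam * b' - lam * b = 0 := by rw [hn', hn0, zero_mul]
    have : lam * b = lam * b' := by linarith
    exact mul_left_cancel₀ hlam.ne' this
  exact ⟨rfl, hA, hB⟩

end Tube

/-! ### The tube is a local diffeomorphism of the mapping torus -/

section Local

variable {ε tj δ r₁ r₂ r₃ lam : ℝ} (ψ : ThreeTorus ≃ₘ⟮𝓣, 𝓣⟯ ThreeTorus)

/-- A real lift of a circle-valued map near a point: `θ₀ + arg (σ d · conj (σ d₁))`. [folklore] -/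
def circleLift (σ : ℂ → Circle) (d₁ : ℂ) (d : ℂ) : ℝ :=
  arg (σ d₁ : ℂ) + arg ((σ d : ℂ) * (starRingEnd ℂ) (σ d₁ : ℂ))

/-- The lift exponentiates back to the map. [folklore] -/
theorem circleExp_circleLift (σ : ℂ → Circle) (d₁ d : ℂ) : Circle.exp (circleLift σ d₁ d) = σ d := by
  rw [circleLift, Circle.exp_add, Circle.exp_arg]
  have h : Circle.exp (arg ((σ d : ℂ) * (starRingEnd ℂ) (σ d₁ : ℂ))) = σ d * (σ d₁)⁻¹ := by
    have hmem : (σ d : ℂ) * (starRingEnd ℂ) (σ d₁ : ℂ) = ((σ d * (σ d₁)⁻¹ : Circle) : ℂ) := by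
      rw [Circle.coe_mul, Circle.coe_inv_eq_conj]
    rw [hmem, Circle.exp_arg]
  rw [h, mul_left_comm, mul_inv_cancel, mul_one]

/-- The lift is smooth near `d₁` where `σ` is smooth. [folklore] -/
theorem contDiffAt_circleLift {σ : ℂ → Circle} {d₁ d : ℂ}
    (hσ : ContMDiffAt 𝓘(ℝ, ℂ) (𝓡 1) ∞ σ d) (hslit : (σ d : ℂ) * (starRingEnd ℂ) (σ d₁ : ℂ) ∈ slitPlane) :
    ContDiffAt ℝ ∞ (circleLift σ d₁) d := by
  unfold circleLift
  refine contDiffAt_const.add ?_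
  have hc : ContMDiffAt 𝓘(ℝ, ℂ) 𝓘(ℝ, ℂ) ∞ (fun d ↦ (σ d : ℂ)) d :=
    contMDiff_coe_circle.contMDiffAt.comp d hσ
  have hc' : ContDiffAt ℝ ∞ (fun d ↦ (σ d : ℂ)) d := contMDiffAt_iff_contDiffAt.1 hc
  exact (contDiffAt_arg hslit).comp d (hc'.mul contDiffAt_const)

/-- Near `d₁` the product `σ d · conj (σ d₁)` lies in the slit plane (it is `1` at `d₁`). [folklore] -/
theorem eventually_mem_slitPlane {σ : ℂ → Circle} {d₁ : ℂ} (hσ : ContinuousAt σ d₁) :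
    ∀ᶠ d in 𝓝 d₁, (σ d : ℂ) * (starRingEnd ℂ) (σ d₁ : ℂ) ∈ slitPlane := by
  have hc : ContinuousAt (fun d ↦ (σ d : ℂ) * (starRingEnd ℂ) (σ d₁ : ℂ)) d₁ :=
    (continuous_subtype_val.continuousAt.comp hσ).mul continuousAt_const
  have h1 : (σ d₁ : ℂ) * (starRingEnd ℂ) (σ d₁ : ℂ) = 1 := by
    rw [← Circle.coe_inv_eq_conj, ← Circle.coe_mul, mul_inv_cancel, Circle.coe_one]
  have hopen : IsOpen slitPlane := isOpen_slitPlane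
  exact hc.preimage_mem_nhds (hopen.mem_nhds (by rw [h1]; exact one_mem_slitPlane))

variable (ε lam)

/-- **The real form of the tube near a point**: `(d, a, b) ↦ ((n - ℓ, λa, ℓ), s)` with
`ℓ = σ̃(d) - λb`, `σ̃` a real lift of `σ`. [folklore] -/
def northReal (σt : ℂ → ℝ) (q : ℂ × ℝ × ℝ) : (𝔼 3) × ℝ :=
  (WithLp.toLp 2 ![capN ε q.1 - (σt q.1 - lam * q.2.2), lam * q.2.1, σt q.1 - lam * q.2.2], capS q.1)

variable {ε lam}

/-- Where the lift exponentiates to `σ`, the tube is `expT` of its real form. [folklore] -/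
theorem northTube_eq_of_lift {σt : ℂ → ℝ} {q : ℂ × ℝ × ℝ}
    (h : Circle.exp (σt q.1) = sigmaCapC tj δ r₁ r₂ r₃ q.1) :
    northTube ε tj δ r₁ r₂ r₃ lam q = (expT (northReal ε lam σt q).1, (northReal ε lam σt q).2) := by
  have hz : northZ3 tj δ r₁ r₂ r₃ lam q.1 q.2.2 = Circle.exp (σt q.1 - lam * q.2.2) := by
    rw [northZ3, ← h, ← Circle.exp_add, sub_eq_add_neg]
  simp only [northTube, northT3, northReal, expT, hz]
  refine Prod.ext (Prod.ext ?_ (Prod.ext ?_ ?_)) rfl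
  · show Circle.exp (capN ε q.1) * (Circle.exp (σt q.1 - lam * q.2.2))⁻¹ = Circle.exp _
    simp only [Matrix.cons_val_zero]
    rw [sub_eq_add_neg (capN ε q.1), Circle.exp_add, Circle.exp_neg]
  · simp
  · simp

/-- The reassembly `((n, s), (y, ℓ)) ↦ ((n - ℓ, y, ℓ), s)`, a diffeomorphism. [folklore] -/
def northAssemble : ((ℝ × ℝ) × (ℝ × ℝ)) ≃ₘ⟮𝓘(ℝ, (ℝ × ℝ) × (ℝ × ℝ)), 𝓘(ℝ, (𝔼 3) × ℝ)⟯ ((𝔼 3) × ℝ) where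
  toFun p := (WithLp.toLp 2 ![p.1.1 - p.2.2, p.2.1, p.2.2], p.1.2)
  invFun q := ((q.1 0 + q.1 2, q.2), (q.1 1, q.1 2))
  left_inv p := by
    obtain ⟨⟨n, s⟩, y, ℓ⟩ := p
    simp
  right_inv q := by
    obtain ⟨v, s⟩ := q
    refine Prod.ext ?_ rfl
    ext j
    fin_cases j <;> simp
  contMDiff_toFun := by
    refine contMDiff_iff_contDiff.2 ?_
    refine ContDiff.prodMk ?_ (contDiff_snd.comp contDiff_fst)
    rw [contDiff_piLp]
    intro j
    fin_cases j
    · exact (contDiff_fst.comp contDiff_fst).sub (contDiff_snd.comp contDiff_snd)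
    · exact contDiff_fst.comp contDiff_snd
    · exact contDiff_snd.comp contDiff_snd
  contMDiff_invFun := by
    refine contMDiff_iff_contDiff.2 ?_
    have hc : ∀ j : Fin 3, ContDiff ℝ ∞ fun q : (𝔼 3) × ℝ ↦ q.1 j := fun j ↦
      (contDiff_piLp_apply (p := 2) (i := j)).comp contDiff_fst
    exact (((hc 0).add (hc 2)).prodMk contDiff_snd).prodMk ((hc 1).prodMk (hc 2))

/-- The value of `northAssemble`. [folklore] -/
@[simp] theorem northAssemble_apply (p : (ℝ × ℝ) × (ℝ × ℝ)) :
    northAssemble p = (WithLp.toLp 2 ![p.1.1 - p.2.2, p.2.1, p.2.2], p.1.2) := rfl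

/-- The real form factors: `northReal = northAssemble ∘ (graph of the shear) ∘ (capChart × id)`. [folklore] -/
theorem northReal_eq (σt : ℂ → ℝ) (hε : 0 < ε) (q : ℂ × ℝ × ℝ) :
    northReal ε lam σt q = northAssemble
      (((capN ε q.1, capS q.1), q.2).1,
        (lam * ((capN ε q.1, capS q.1), q.2).2.1,
          σt (capPt ε ((capN ε q.1, capS q.1), q.2).1.1 ((capN ε q.1, capS q.1), q.2).1.2) -
            lam * ((capN ε q.1, capS q.1), q.2).2.2)) := by
  simp only [northReal, northAssemble_apply, capPt_capN_capS hε]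

/-- **The real form of the tube is a local diffeomorphism** where `d` is in the slit plane, `σ̃`
is smooth and `λ ≠ 0`. [folklore] -/
theorem isLocalDiffeomorphAt_northReal {σt : ℂ → ℝ} (hε : 0 < ε) (hlam : lam ≠ 0) {q : ℂ × ℝ × ℝ}
    (hd : q.1 ∈ slitPlane) (hσt : ∀ᶠ d in 𝓝 q.1, ContDiffAt ℝ ∞ σt d) :
    IsLocalDiffeomorphAt 𝓘(ℝ, ℂ × ℝ × ℝ) 𝓘(ℝ, (𝔼 3) × ℝ) ∞ (northReal ε lam σt) q := by
  -- (1) the cap chart times the identity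
  have h1 : IsLocalDiffeomorphAt 𝓘(ℝ, ℂ × ℝ × ℝ) 𝓘(ℝ, (ℝ × ℝ) × (ℝ × ℝ)) ∞
      (fun q : ℂ × ℝ × ℝ ↦ ((capN ε q.1, capS q.1), q.2)) q := by
    have h := IsLocalDiffeomorphAt.prodMap' (isLocalDiffeomorphAt_capChart hε hd)
      ((Diffeomorph.refl 𝓘(ℝ, ℝ × ℝ) (ℝ × ℝ) ∞).isLocalDiffeomorph q.2)
    rw [← modelWithCornersSelf_prod, ← modelWithCornersSelf_prod, chartedSpaceSelf_prod,
      chartedSpaceSelf_prod] at h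
    exact h
  -- (2) the shear `((n, s), (a, b)) ↦ ((n, s), (λ a, σ̃(capPt n s) - λ b))`
  obtain ⟨U, hU, hUo, hqU⟩ : ∃ U : Set ℂ, (∀ d ∈ U, ContDiffAt ℝ ∞ σt d) ∧ IsOpen U ∧ q.1 ∈ U := by
    obtain ⟨U, hU, hUo, hq⟩ := mem_nhds_iff.1 hσt
    exact ⟨U, fun d hd ↦ hU hd, hUo, hq⟩
  set p₀ : (ℝ × ℝ) × (ℝ × ℝ) := ((capN ε q.1, capS q.1), q.2) with hp₀
  have hp₀t : p₀.1 ∈ capChartTarget ε := (capChart hε).map_source hd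
  have h2 : IsLocalDiffeomorphAt 𝓘(ℝ, (ℝ × ℝ) × (ℝ × ℝ)) 𝓘(ℝ, (ℝ × ℝ) × (ℝ × ℝ)) ∞
      (fun p : (ℝ × ℝ) × (ℝ × ℝ) ↦ (p.1, (lam * p.2.1, σt (capPt ε p.1.1 p.1.2) - lam * p.2.2))) p₀ := by
    set W : Set ((ℝ × ℝ) × (ℝ × ℝ)) := {p | p.1 ∈ capChartTarget ε ∧ capPt ε p.1.1 p.1.2 ∈ U} with hW
    have hcapPt : ContinuousOn (fun p : (ℝ × ℝ) × (ℝ × ℝ) ↦ capPt ε p.1.1 p.1.2) {p | p.1 ∈ capChartTarget ε} :=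
      ((contDiffOn_capPt ε).continuousOn.comp continuous_fst.continuousOn fun p hp ↦ hp.1)
    have hWo : IsOpen W := hcapPt.isOpen_inter_preimage ((isOpen_capChartTarget ε).preimage continuous_fst) hUo
    have hp₀W : p₀ ∈ W := ⟨hp₀t, by rw [hp₀]; simp only; rw [capPt_capN_capS hε]; exact hqU⟩
    have hf : ContDiffOn ℝ ∞ (fun p : (ℝ × ℝ) × (ℝ × ℝ) ↦ (lam * p.2.1, σt (capPt ε p.1.1 p.1.2) - lam * p.2.2)) W := by
      intro p hp
      have hct : ContDiffAt ℝ ∞ (fun p : (ℝ × ℝ) × (ℝ × ℝ) ↦ capPt ε p.1.1 p.1.2) p := by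
        have h := (contDiffOn_capPt ε).contDiffAt
          ((isOpen_lt (continuous_fst.pow 2) continuous_const).mem_nhds hp.1.1)
        exact h.comp p contDiffAt_fst
      have hσ' : ContDiffAt ℝ ∞ (fun p : (ℝ × ℝ) × (ℝ × ℝ) ↦ σt (capPt ε p.1.1 p.1.2)) p :=
        (hU _ hp.2).comp p hct
      exact ((contDiffAt_const.mul (contDiffAt_fst.comp p contDiffAt_snd)).prodMk
        (hσ'.sub (contDiffAt_const.mul (contDiffAt_snd.comp p contDiffAt_snd)))).contDiffWithinAt
    refine isLocalDiffeomorphAt_graph hWo hp₀W hf (by exact_mod_cast le_top)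
      (pair2EquivProd (lam, 0) (0, -lam) (by simp [hlam])) ?_
    have hu : HasDerivAt (fun a ↦ (lam * a, σt (capPt ε p₀.1.1 p₀.1.2) - lam * p₀.2.2)) (lam, 0) p₀.2.1 := by
      refine HasDerivAt.prodMk ?_ (hasDerivAt_const _ _)
      simpa using (hasDerivAt_id p₀.2.1).const_mul lam
    have hv : HasDerivAt (fun b ↦ (lam * p₀.2.1, σt (capPt ε p₀.1.1 p₀.1.2) - lam * b)) (0, -lam) p₀.2.2 := by
      refine (hasDerivAt_const _ _).prodMk ?_
      simpa using ((hasDerivAt_id p₀.2.2).const_mul lam).const_sub (σt (capPt ε p₀.1.1 p₀.1.2))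
    have hdiff : DifferentiableAt ℝ (fun x : ℝ × ℝ ↦ (lam * x.1, σt (capPt ε p₀.1.1 p₀.1.2) - lam * x.2)) p₀.2 :=
      ((differentiableAt_const _).mul differentiableAt_fst).prodMk
        ((differentiableAt_const _).sub ((differentiableAt_const _).mul differentiableAt_snd))
    have h := hasFDerivAt_of_partials hdiff hu hv
    rw [coe_pair2EquivProd]
    exact h
  -- (3) the reassembly
  have h3 := northAssemble.isLocalDiffeomorph
    (p₀.1, (lam * p₀.2.1, σt (capPt ε p₀.1.1 p₀.1.2) - lam * p₀.2.2))
  have h := (h1.comp (K := 𝓘(ℝ, (ℝ × ℝ) × (ℝ × ℝ))) (P := (ℝ × ℝ) × (ℝ × ℝ)) h2).comp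
    (K := 𝓘(ℝ, (𝔼 3) × ℝ)) (P := (𝔼 3) × ℝ) h3
  refine isLocalDiffeomorphAt_congr_nhds' h (Filter.Eventually.of_forall fun q' ↦ ?_)
  exact northReal_eq σt hε q'

/-- **The tube, read in the mapping torus, is a local diffeomorphism** at points with `d` in the
slit plane where `σ` is smooth (for `λ ≠ 0`). [folklore] -/
theorem isLocalDiffeomorphAt_mtPt_northTube (hε : 0 < ε) (hlam : lam ≠ 0) {q : ℂ × ℝ × ℝ}
    (hd : q.1 ∈ slitPlane) (hσ : ∀ᶠ d in 𝓝 q.1, ContMDiffAt 𝓘(ℝ, ℂ) (𝓡 1) ∞ (sigmaCapC tj δ r₁ r₂ r₃) d) :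
    IsLocalDiffeomorphAt 𝓘(ℝ, ℂ × ℝ × ℝ) 𝓘(ℝ, 𝔼 4) ∞
      (fun q : ℂ × ℝ × ℝ ↦ mtPt ψ (northTube ε tj δ r₁ r₂ r₃ lam q).1 (northTube ε tj δ r₁ r₂ r₃ lam q).2) q := by
  set σt := circleLift (sigmaCapC tj δ r₁ r₂ r₃) q.1 with hσt
  -- the lift is smooth near `q.1`
  have hcont : ContinuousAt (sigmaCapC tj δ r₁ r₂ r₃) q.1 := hσ.self_of_nhds.continuousAt
  have hslit := eventually_mem_slitPlane hcont
  have hσt' : ∀ᶠ d in 𝓝 q.1, ContDiffAt ℝ ∞ σt d := by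
    filter_upwards [hσ, hslit] with d hd hd'
    exact contDiffAt_circleLift hd hd'
  -- the real form and the exponential coordinates
  have hR := isLocalDiffeomorphAt_northReal hε hlam hd hσt'
  have hs : 0 < (northReal ε lam σt q).2 ∧ (northReal ε lam σt q).2 < 3 / 2 := by
    have h := capS_mem_of_mem_slitPlane hd
    exact ⟨by simp only [northReal]; linarith [h.1], by simp only [northReal]; exact h.2⟩
  have hC : IsLocalDiffeomorphAt 𝓘(ℝ, (𝔼 3) × ℝ) 𝓘(ℝ, 𝔼 4) ∞ (mtCoord ψ) (northReal ε lam σt q) := by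
    have h := isLocalDiffeomorphAt_mtCoord (ψ := ψ) hs.1 hs.2
    rw [← modelWithCornersSelf_prod, chartedSpaceSelf_prod] at h
    exact h
  have h := hR.comp (K := 𝓘(ℝ, 𝔼 4)) (P := MTorus ψ) hC
  refine isLocalDiffeomorphAt_congr_nhds' h ?_
  have hev : ∀ᶠ q' in 𝓝 q, Circle.exp (σt q'.1) = sigmaCapC tj δ r₁ r₂ r₃ q'.1 :=
    Filter.Eventually.of_forall fun q' ↦ circleExp_circleLift _ _ _
  filter_upwards [hev] with q' hq'
  show mtPt ψ _ _ = mtCoord ψ (northReal ε lam σt q')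
  rw [northTube_eq_of_lift hq', mtCoord]

end Local

end Literature.Topology.FourManifolds
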